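import Summits.Ventures.YMGap.RobustBall.ZNFluxWindowPeeling
import HarnessLib

/-!
# RobustBall/ZNFluxGenPeeling — windowed Durhuus–Fröhlich peeling for `ℤ_N` lattice gauge theories with finite-range flux interactions,
# from a per-rung two-point bound of GENERAL SHAPE `F(dist_j)`

HONEST FRAMING: venture file of the cell `pub-ymgap` (QuantumFields programme), track Y2 ROBUST-BALL, seat ds-4 g9.  Finite sums on a finite
torus; no `SU(N)` measure here; nothing about the continuum.  This is `ZNFluxWindowPeeling.norm_cavg_ψ_loopSum_le_window` (gen 8) /
`ZNFluxLinkPeeling.norm_cavg_ψ_loopSum_le_of_twoPoint` (gen 9) with the per-rung two-point estimate abstracted to an ARBITRARY function `F` of the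
transverse distance: `‖E ψ(σ_b − σ_t)‖ ≤ F(dist_j(t,b))` for the block-conditioned layer system ⇒ `‖⟨ψ(∮_{∂R×T} k)⟩‖ ≤ F(T)^{#{r<R : m∣r}}`
(`norm_cavg_ψ_loopSum_le_of_bound`).  Written for the Simon–Lieb STAR bound of the centre-projected `ℤ₂` layer (`IsingStarDecay`), whose shape
`φ^{⌊T/2⌋}` is not `4c^{⌈T/s⌉}`.  Mechanism unchanged (transverse conditioning, block conditioning on the unselected heights, factorisation).
-/

noncomputable section

open Finset Function
open Literature.MathematicalPhysics.QuantumFieldTheory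

namespace Summit.Ventures.YMGap.RobustBall

namespace ZNFluxW

open ZN

variable {d L N : ℕ} [NeZero L] [NeZero N] {ι : Type*} [Fintype ι]

/-! ### Factor: the per-rung bound as a hypothesis -/

section Factor

variable {supp : ι → Finset (Plaquette d L)} {g : ι → (Plaquette d L → ZMod N) → ℝ}
  (hdep : ∀ t, DependsOn (g t) (↑(supp t) : Set (Plaquette d L))) (i j : Fin d) (hij : i ≠ j) {m : ℕ}
  (hwin : ∀ t, ∀ y ∈ iLinks i (supp t), ∀ y' ∈ iLinks i (supp t), (y i - y' i).valMinAbs.natAbs < m)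
  (x : Site d L) (R T : ℕ) (hRL : 2 * R ≤ L) (kT : Transverse d L (ZMod N) i) (κ : Site d L → ZMod N)

include hdep hij hwin hRL in
/-- **Windowed layer bound from a per-rung two-point bound of general shape**: if every two-point function of the block-conditioned
weight obeys `‖E ψ(σ_b − σ_t)‖ ≤ F(dist_j(t,b))`, then `‖E ψ(rung_R ∘ block.piecewise · κ)‖ ≤ F(T)^{#selIdx m R}`. [folklore] -/
theorem norm_cavg_ψ_rung_piecewise_le_of_bound {F : ℕ → ℝ}
    (htwo : ∀ b t : Site d L, ‖FiniteGibbs.cavg (layerWeightW g i (selH x i m R) kT κ) (fun σ => ψ N (σ b - σ t))‖ ≤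
      F (jDist j t b)) (hT : 2 * T ≤ L) :
    ‖FiniteGibbs.cavg (layerWeightW g i (selH x i m R) kT κ)
        (fun σ => ψ N (rung x i j T R ((block i (selH x i m R)).piecewise σ κ)))‖ ≤
      F T ^ (selIdx m R).card := by
  classical
  -- the unselected rungs are a unimodular constant
  have hsplit : (fun σ : Site d L → ZMod N => ψ N (rung x i j T R ((block i (selH x i m R)).piecewise σ κ))) =
      fun σ => ψ N (rungSel m x i j T R σ) *
        ψ N (∑ r ∈ (Finset.range R).filter (fun r => ¬m ∣ r), (κ (bot x i r) - κ (top x i j T r))) := by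
    funext σ; rw [rung_piecewise hij x T hRL, ψ_add]
  have hconst : FiniteGibbs.cavg (layerWeightW g i (selH x i m R) kT κ)
      (fun σ => ψ N (rungSel m x i j T R σ) *
        ψ N (∑ r ∈ (Finset.range R).filter (fun r => ¬m ∣ r), (κ (bot x i r) - κ (top x i j T r)))) =
      FiniteGibbs.cavg (layerWeightW g i (selH x i m R) kT κ) (fun σ => ψ N (rungSel m x i j T R σ)) *
        ψ N (∑ r ∈ (Finset.range R).filter (fun r => ¬m ∣ r), (κ (bot x i r) - κ (top x i j T r))) := by
    simp only [FiniteGibbs.cavg]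
    rw [div_mul_eq_mul_div, Finset.sum_mul]
    congr 1
    exact Finset.sum_congr rfl fun σ _ => by ring
  rw [hsplit, hconst, norm_mul, norm_ψ, mul_one, cavg_ψ_rungSel_eq_prod hdep i j hij hwin x R T hRL kT κ R le_rfl,
    norm_prod, ← Finset.prod_const]
  refine Finset.prod_le_prod (fun r _ => norm_nonneg _) fun r _ => ?_
  have h := htwo (bot x i r) (top x i j T r)
  rwa [show jDist j (top x i j T r) (bot x i r) = T from jDist_rung hij x r T hT] at h

end Factor

/-! ### The uniform windowed bound from the abstract two-point bound -/

/-- **UNIFORM AREA-LAW BOUND FOR `ℤ_N` LATTICE GAUGE THEORIES WITH FINITE-RANGE FLUX INTERACTIONS, FROM A PER-RUNG TWO-POINT BOUND OF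
GENERAL SHAPE**: terms with `DependsOn` plaquette supports inside a vertical window `m`; if for every selected set `H`, transverse `kT`, frozen
`κ` the block-conditioned layer system has `‖E ψ(σ_b − σ_t)‖ ≤ F(dist_j(t,b))`, then for every non-wrapping `R × T` rectangle in the `(i, j)`
plane `‖⟨ψ(∮_{∂R×T} k)⟩‖ ≤ F(T)^{#{r < R : m ∣ r}}`.  (`ZNFluxLinkPeeling.norm_cavg_ψ_loopSum_le_of_twoPoint` is `F(D) = 4c^{⌈D/s⌉}`; the
Simon–Lieb star bound of `IsingStarDecay` has the shape `F(D) = φ^{⌊D/2⌋}`.) [cite: MackPetkova1979, §2] -/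
theorem norm_cavg_ψ_loopSum_le_of_bound {supp : ι → Finset (Plaquette d L)}
    {g : ι → (Plaquette d L → ZMod N) → ℝ}
    (hdep : ∀ t, DependsOn (g t) (↑(supp t) : Set (Plaquette d L)))
    {i j : Fin d} (hij : i ≠ j) {m : ℕ}
    (hwin : ∀ t, ∀ y ∈ iLinks i (supp t), ∀ y' ∈ iLinks i (supp t), (y i - y' i).valMinAbs.natAbs < m)
    {F : ℕ → ℝ}
    (htwo : ∀ (H : Finset (ZMod L)) (kT : Transverse d L (ZMod N) i) (κ : Site d L → ZMod N) (b t : Site d L),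
      ‖FiniteGibbs.cavg (layerWeightW g i H kT κ) (fun σ => ψ N (σ b - σ t))‖ ≤ F (jDist j t b))
    (x : Site d L) {R T : ℕ} (hR : 2 * R ≤ L) (hT : 2 * T ≤ L) :
    ‖FiniteGibbs.cavg (znWD g) (fun k => ψ N (loopSum k x i j R T))‖ ≤ F T ^ (selIdx m R).card := by
  classical
  set M := F T ^ (selIdx m R).card with hM
  have hmass : 0 < FiniteGibbs.mass (znWD (N := N) (L := L) g) := FiniteGibbs.mass_pos_of_pos fun k => Real.exp_pos _
  rw [FiniteGibbs.cavg, norm_div, Complex.norm_real, Real.norm_eq_abs, abs_of_pos hmass, div_le_iff₀ hmass]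
  -- split numerator and mass into transverse and layer sums
  rw [sum_eq_sum_sum_glue i, FiniteGibbs.mass, sum_eq_sum_sum_glue i, Finset.mul_sum]
  refine (norm_sum_le _ _).trans (Finset.sum_le_sum fun kT _ => ?_)
  -- the layer weight given `kT`
  set w : (Site d L → ZMod N) → ℝ := fun kI => znWD g (glue i kI kT) with hw
  have hwpos : ∀ kI, 0 < w kI := fun kI => Real.exp_pos _
  have hwmass : 0 < FiniteGibbs.mass w := FiniteGibbs.mass_pos_of_pos hwpos
  -- on the fibre of `kT` the transverse sides are a unimodular constant
  have hfac : ∑ kI : Site d L → ZMod N, (znWD g (glue i kI kT) : ℂ) * ψ N (loopSum (glue i kI kT) x i j R T) =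
      ψ N (transLine j hij kT T (x + Pi.single i ((R : ℕ) : ZMod L)) - transLine j hij kT T x) *
        ∑ kI : Site d L → ZMod N, (w kI : ℂ) * ψ N (rung x i j T R kI) := by
    rw [Finset.mul_sum]
    refine Finset.sum_congr rfl fun kI _ => ?_
    rw [hw, loopSum_glue hij, ψ_add]; ring
  have hlayer : ∑ kI : Site d L → ZMod N, (w kI : ℂ) * ψ N (rung x i j T R kI) =
      (FiniteGibbs.mass w : ℂ) * FiniteGibbs.cavg w (fun kI => ψ N (rung x i j T R kI)) := by
    rw [FiniteGibbs.cavg, mul_div_cancel₀]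
    rw [Ne, Complex.ofReal_eq_zero]; exact hwmass.ne'
  -- block conditioning on the unselected `i`-links
  have hblock : ‖FiniteGibbs.cavg w (fun kI => ψ N (rung x i j T R kI))‖ ≤ M :=
    ZNSpin.norm_cavg_le_of_piecewise (block i (selH x i m R)) (fun kI => (hwpos kI).le) hwmass _ fun κ _ =>
      norm_cavg_ψ_rung_piecewise_le_of_bound hdep i j hij hwin x R T hR kT κ (htwo _ kT κ) hT
  rw [hfac, hlayer, norm_mul, norm_ψ, one_mul, norm_mul, Complex.norm_real, Real.norm_eq_abs, abs_of_pos hwmass]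
  have hmass_eq : FiniteGibbs.mass w = ∑ kI : Site d L → ZMod N, znWD g (glue i kI kT) := rfl
  rw [hmass_eq, mul_comm]
  exact mul_le_mul_of_nonneg_right hblock (Finset.sum_nonneg fun kI _ => (Real.exp_pos _).le)


end ZNFluxW

end Summit.Ventures.YMGap.RobustBall

end
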